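import Literature.AlgebraicGeometry.Morphisms.ProjectiveOverBaseOfFibres
import Literature.AlgebraicGeometry.Morphisms.ProjectiveOfFibresEmbedding
import HarnessLib

/-!
# Fibrewise very ample + `H¹ = 0` on affine charts ⇒ projective over a GENERAL base (EGA III 4.7.1, global form)

Topic `AlgebraicGeometry/Morphisms`; namespace `Literature.AlgebraicGeometry.Morphisms`. THEOREMS ONLY (no definition, no named
fact, no instance, no `sorry`).

This file joins ★ `Morphisms/ProjectiveOverBaseOfFibres` (a global generating-sections datum embeds `X ↪ 𝐏(ι; T)` iff it does
so on every fibre — ANY base scheme `T`) with ★ `Morphisms/ProjectiveOfFibresEmbedding` §1 (over an affine noetherian chart on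
which `f` is flat and the global sections `b` span `Γ(E)`: a fibre with `Ext¹(𝒪, E|_{X₀}) = 0` embedded by its own complete linear
system is embedded by the restricted `b`). The glue is §1:

* `comap_comp_eq_comap_ofFrameSystem_pullback` — for a chart `g : X' → X` and `h : X₀ → X'`, the datum of the global sections
  `b` restricted along `h ≫ g` IS the datum of the pulled-back sections `η_g(b)` (in the pulled-back frames) restricted along `h`
  (★ `comap_comp` + ★ `ofCocycleSections_comap` + ★ `ofCocycleSections_ofFrameSystem_pullback`); hence the same `toProj`.

and §2 is the assembly over a general base:

* `iSup_basicOpen_coeffAt_eq_top_of_charts` / **`isProjective_of_fibres_embedding_of_charts`**: `f : X → T` PROPER and FLAT,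
  `E` with a rank-one frame system `F`, `b₀,…,b_m ∈ Γ(X, E)`; suppose every `t ∈ T` has an affine NOETHERIAN chart
  `Spec A → T` (cartesian square `X' = X ×_T Spec A`) over which the `η(b_j)` SPAN `Γ(X', E|_{X'})` over `A`, and a prime `𝔭`
  under `t` whose fibre (any presentation) has `Ext¹(𝒪, E|_{X₀}) = 0` and is embedded by finitely many of its own sections.
  Then the `b_j` generate `E` and `f` is PROJECTIVE (`IsProjective`), the `b_j` embedding `X ↪ 𝐏^m_T`.

This is the form the F-6 functor side uses over a non-affine `T`: «`(A/T, λ, level, frame b of π_*L^Δ(λ)³)` ↦ `A ↪ 𝐏^m_T`»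
(Mumford–Fogarty–Kirwan Prop. 7.3; the frame spans on every affine open, the fibres are abelian varieties). Cell `hodgecm-mathlib`,
F-DAG (h2)/F-6 capital (B-p20 (g11)); count-neutral (HC_CM is proved only modulo the 7 printed citations until rung 0 closes).

## References
* A. Grothendieck, J. Dieudonné, *EGA III₁* (Publ. Math. IHÉS 11, 1961), Thm. 4.7.1, Prop. 4.6.7 (ii). [EGAIII1]
* R. Hartshorne, *Algebraic Geometry* (1977), II Thm. 7.1; II §4 Definition p.103 (projective morphism). [Hartshorne1977]
* D. Mumford, J. Fogarty, F. Kirwan, *Geometric Invariant Theory*, 3rd ed. (1994), Ch. 7 §2, Prop. 7.3. [MumfordFogartyKirwan1994]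
-/

noncomputable section

-- `TopCat.Presheaf`/`Scheme.Modules` and pull-back bookkeeping (as in ★ `Morphisms/ProjectiveOfFibreEmbedding`).
set_option backward.isDefEq.respectTransparency false

universe u

open CategoryTheory CategoryTheory.Limits CategoryTheory.Abelian AlgebraicGeometry TopologicalSpace
open Literature.AlgebraicGeometry.Modules
open Literature.AlgebraicGeometry.Motives Literature.AlgebraicGeometry.Motives.GeneratingSections

namespace Literature.AlgebraicGeometry.Morphisms

attribute [local instance] MvPolynomial.gradedAlgebra

/-! ## §1 Glue: restricting the global datum along a chart is the datum of the pulled-back sections -/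

section Glue

variable {X X' X₀ : Scheme.{u}} (g : X' ⟶ X) (h : X₀ ⟶ X') {E : X.Modules} (F : FrameSystem E) (h1 : ∀ x, F.rank x = 1)
  {ι : Type} (b : ι → Γ(E, ⊤)) (hcovb : ⨆ i, ⨆ x, X.basicOpen ((CocycleSections.ofFrameSystem F h1 b).coeff i x) = ⊤)
  (h1' : ∀ x, (F.pullback g).rank x = 1)
  (hcov' : ⨆ i, ⨆ x, X'.basicOpen ((CocycleSections.ofFrameSystem (F.pullback g) h1'
    (fun i => unitSectionLE g E (V := ⊤) (U := ⊤) le_top (b i))).coeff i x) = ⊤)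

/-- **Restriction along a chart, then along a fibre = restriction of the pulled-back sections along the fibre**: the datum of
the global sections `b` pulled back along `h ≫ g` is the datum of `η_g(b)` (in the pulled-back frames on `X'`) pulled back
along `h`. [cite: Hartshorne1977, II Thm. 7.1] -/
theorem comap_comp_eq_comap_ofFrameSystem_pullback :
    (ofCocycleSections F.U (CocycleSections.ofFrameSystem F h1 b) hcovb).comap (h ≫ g) =
      (ofCocycleSections (F.pullback g).U (CocycleSections.ofFrameSystem (F.pullback g) h1'
        (fun i => unitSectionLE g E (V := ⊤) (U := ⊤) le_top (b i))) hcov').comap h := by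
  rw [comap_comp, ofCocycleSections_ofFrameSystem_pullback g F h1 b h1' hcov'
    (CocycleSections.iSup_basicOpen_comap_coeff g _ hcovb), ofCocycleSections_comap]

include hcov' in
/-- The same one level down: the datum of `b` pulled back along `h ≫ g` is `ofCocycleSections` of the coefficients of
`η_g(b)` pulled back along `h` (★ `ofCocycleSections_comap`). [cite: Hartshorne1977, II Thm. 7.1] -/
theorem comap_comp_eq_ofCocycleSections_comap
    (hcov₀ : ⨆ i, ⨆ a, X₀.basicOpen (((CocycleSections.ofFrameSystem (F.pullback g) h1'
      (fun i => unitSectionLE g E (V := ⊤) (U := ⊤) le_top (b i))).comap h).coeff i a) = ⊤) :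
    (ofCocycleSections F.U (CocycleSections.ofFrameSystem F h1 b) hcovb).comap (h ≫ g) =
      ofCocycleSections (fun x => h ⁻¹ᵁ (F.pullback g).U x) ((CocycleSections.ofFrameSystem (F.pullback g) h1'
        (fun i => unitSectionLE g E (V := ⊤) (U := ⊤) le_top (b i))).comap h) hcov₀ := by
  rw [comap_comp_eq_comap_ofFrameSystem_pullback g h F h1 b hcovb h1' hcov', ← ofCocycleSections_comap]

include hcov' in
/-- Hence, over any base ring `k` for the fibre: the morphism to `ℙ^ι_k` of `b` restricted along `h ≫ g` is a closed immersion
as soon as the morphism of the pulled-back sections restricted along `h` is. [cite: Hartshorne1977, II Thm. 7.1] -/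
theorem isClosedImmersion_toProj_comap_comp {k : Type u} [CommRing k] (f₀ : X₀ ⟶ Spec (.of k))
    (hcov₀ : ⨆ i, ⨆ a, X₀.basicOpen (((CocycleSections.ofFrameSystem (F.pullback g) h1'
      (fun i => unitSectionLE g E (V := ⊤) (U := ⊤) le_top (b i))).comap h).coeff i a) = ⊤)
    (H : IsClosedImmersion ((ofCocycleSections (fun x => h ⁻¹ᵁ (F.pullback g).U x)
      ((CocycleSections.ofFrameSystem (F.pullback g) h1' (fun i => unitSectionLE g E (V := ⊤) (U := ⊤) le_top (b i))).comap h)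
      hcov₀).toProj f₀)) :
    IsClosedImmersion (((ofCocycleSections F.U (CocycleSections.ofFrameSystem F h1 b) hcovb).comap (h ≫ g)).toProj f₀) := by
  rw [comap_comp_eq_ofCocycleSections_comap g h F h1 b hcovb h1' hcov' hcov₀]
  exact H

end Glue

/-! ## §2 Assembly over a general base -/

section General

variable {X T : Scheme.{0}} (f : X ⟶ T) [IsProper f] [Flat f] {E : X.Modules} (F : FrameSystem E) (h1 : ∀ x, F.rank x = 1)
  {m : ℕ} (b : Fin (m + 1) → Γ(E, ⊤))
  (H : ∀ t : T, ∃ (A : Type) (_ : CommRing A) (_ : IsNoetherianRing A) (iV : Spec (.of A) ⟶ T) (X' : Scheme.{0})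
    (g : X' ⟶ X) (f' : X' ⟶ Spec (.of A)) (_ : IsPullback g f' f iV)
    (_ : Submodule.span Γ(Spec (.of A), ⊤) (Set.range fun j ↦ SecMod.mk (L := (Scheme.Modules.pullback g).obj E)
      (ρ := f'.appTop.hom) (U := ⊤) (unitSectionLE g E (V := ⊤) (U := ⊤) le_top (b j))) = ⊤)
    (𝔭 : PrimeSpectrum A) (σ : Spec (T.residueField t) ⟶ Spec (.of 𝔭.asIdeal.ResidueField))
    (_ : σ ≫ Spec.map (CommRingCat.ofHom (algebraMap A 𝔭.asIdeal.ResidueField)) ≫ iV = T.fromSpecResidueField t)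
    (X₀ : Scheme.{0}) (iX : X₀ ⟶ X') (f₀ : X₀ ⟶ Spec (.of 𝔭.asIdeal.ResidueField))
    (_ : IsPullback iX f₀ f' (Spec.map (CommRingCat.ofHom (algebraMap A 𝔭.asIdeal.ResidueField))))
    (_ : Subsingleton (Ext.{1} (unitModule X₀) ((Scheme.Modules.pullback iX).obj ((Scheme.Modules.pullback g).obj E)) 1))
    (h1₀ : ∀ x, ((F.pullback g).pullback iX).rank x = 1) (n : ℕ)
    (s : Fin (n + 1) → Γ((Scheme.Modules.pullback iX).obj ((Scheme.Modules.pullback g).obj E), ⊤))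
    (hcov : ⨆ i, ⨆ x, X₀.basicOpen ((CocycleSections.ofFrameSystem ((F.pullback g).pullback iX) h1₀ s).coeff i x) = ⊤),
    IsClosedImmersion ((ofCocycleSections ((F.pullback g).pullback iX).U
      (CocycleSections.ofFrameSystem ((F.pullback g).pullback iX) h1₀ s) hcov).toProj f₀))

include h1 H

omit h1 H in
/-- In a cartesian square `fst ≫ f = snd ≫ g`, a pair of points `x`, `y` with `f x = g y` is hit by one point of the corner.
[folklore] -/
private theorem exists_fst_eq_and_snd_eq {P X' Y Z : Scheme.{u}} {fst : P ⟶ X'} {snd : P ⟶ Y} {f : X' ⟶ Z}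
    {g : Y ⟶ Z} (hP : IsPullback fst snd f g) (x : X') (y : Y) (hxy : f x = g y) :
    ∃ p : P, fst p = x ∧ snd p = y := by
  haveI : HasPullback f g := hP.hasPullback
  obtain ⟨z, hz, hz'⟩ := Scheme.Pullback.exists_preimage_pullback x y hxy
  refine ⟨hP.isoPullback.inv z, ?_, ?_⟩
  · rw [← Scheme.Hom.comp_apply, IsPullback.isoPullback_inv_fst, hz]
  · rw [← Scheme.Hom.comp_apply, IsPullback.isoPullback_inv_snd, hz']

omit H in
/-- If the `b_j` generate `E` on `X`, the pulled-back sections `η_g(b_j)` generate `g^*E` on `X'` (in the pulled-back frames;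
★ `coeffAt_pullback`). [cite: Hartshorne1977, II Thm. 7.1] -/
theorem iSup_basicOpen_coeffAt_pullback_eq_top {X' : Scheme.{0}} (g : X' ⟶ X) (h1' : ∀ x, (F.pullback g).rank x = 1)
    (hcovb : ⨆ j, ⨆ x : X, X.basicOpen (coeffAt F h1 b j x) = ⊤) :
    ⨆ j, ⨆ x : X', X'.basicOpen (coeffAt (F.pullback g) h1'
      (fun j => unitSectionLE g E (V := ⊤) (U := ⊤) le_top (b j)) j x) = ⊤ := by
  refine (iSup_basicOpen_coeffAt_eq_top_iff (F.pullback g) h1' _).mpr fun x ↦ ?_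
  obtain ⟨j, hj⟩ := (iSup_basicOpen_coeffAt_eq_top_iff F h1 b).mp hcovb (g.base x)
  refine ⟨j, ?_⟩
  rw [coeffAt_pullback g F h1 b h1' j x, ← Scheme.preimage_basicOpen]
  exact hj

/-- **The global sections generate everywhere** (charts cover: every `t` lies in the image of its chart, and on the chart the
`η(b_j)` generate along the fibre by ★ `isClosedImmersion_toProj_comap_of_fibre_embedding_of_span`; coefficients pull back,
★ `mem_basicOpen_coeffAt_of_pullback`). [cite: EGAIII1, Thm. 4.7.1] -/
theorem iSup_basicOpen_coeffAt_eq_top_of_charts :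
    ⨆ j, ⨆ x : X, X.basicOpen (GeneratingSections.coeffAt F h1 b j x) = ⊤ := by
  refine (iSup_basicOpen_coeffAt_eq_top_iff F h1 b).mpr fun x ↦ ?_
  obtain ⟨A, _, _, iV, X', g, f', Hg, hb', 𝔭, σ, hσ, X₀, iX, f₀, HX, hvan, h1₀, n, s, hcov, H₀⟩ := H (f x)
  haveI : IsProper f' := MorphismProperty.of_isPullback Hg inferInstance
  haveI : Flat f' := MorphismProperty.of_isPullback Hg inferInstance
  -- `f x = iV 𝔭`, so `x = g x'` with `f' x' = 𝔭`
  have hpt : T.fromSpecResidueField (f x) (⊥ : PrimeSpectrum (T.residueField (f x))) = f x :=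
    Scheme.fromSpecResidueField_apply _ _
  have hκ : ∀ q : PrimeSpectrum 𝔭.asIdeal.ResidueField,
      PrimeSpectrum.comap (algebraMap A 𝔭.asIdeal.ResidueField) q = 𝔭 := fun q ↦ by
    ext1
    rw [PrimeSpectrum.comap_asIdeal, Ideal.eq_bot_of_prime q.asIdeal, ← RingHom.ker_eq_comap_bot,
      Ideal.ker_algebraMap_residueField]
  have hfx : f x = iV 𝔭 := by
    conv_lhs => rw [← hpt, ← hσ]
    rw [Scheme.Hom.comp_apply, Scheme.Hom.comp_apply]
    exact congrArg iV (hκ _)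
  obtain ⟨x', rfl, hx'⟩ := exists_fst_eq_and_snd_eq Hg x 𝔭 hfx
  -- ★ §1 of `ProjectiveOfFibresEmbedding` on the chart: the `η(b_j)` generate along the fibre over `𝔭`
  obtain ⟨hgen, -⟩ := isClosedImmersion_toProj_comap_of_fibre_embedding_of_span f' 𝔭 HX (F.pullback g) (fun _ ↦ h1 _)
    hvan h1₀ s hcov H₀ (fun j ↦ unitSectionLE g E (V := ⊤) (U := ⊤) le_top (b j)) hb'
  obtain ⟨j, hj⟩ := hgen x' hx'
  exact ⟨j, mem_basicOpen_coeffAt_of_pullback g F h1 b (fun _ ↦ h1 _) j x' hj⟩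

/-- **EGA III 4.7.1 over a general base: fibrewise very ample with `H¹ = 0` on affine noetherian charts ⇒ PROJECTIVE.**
`f : X → T` proper and flat, `F` a rank-one frame system of `E`, `b₀,…,b_m ∈ Γ(X, E)`; every `t ∈ T` has an affine noetherian
chart `Spec A → T` over which the `η(b_j)` span `Γ(E|_{X ×_T Spec A})` and a prime `𝔭` under `t` whose fibre (any presentation)
has `Ext¹(𝒪, E|_{X₀}) = 0` and is embedded by finitely many of its own sections. Then `f` is projective: the `b_j` embed
`X ↪ 𝐏^m_T` (★ `isProjective_of_generatingSections_fin_of_isPullback`, chart by chart via §1 and ★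
`isClosedImmersion_toProj_comap_of_fibre_embedding_of_span`). [cite: EGAIII1, Thm. 4.7.1]
[cite: Hartshorne1977, II §4 Definition p.103 (projective morphism)] -/
theorem isProjective_of_fibres_embedding_of_charts : Morphisms.IsProjective f := by
  have hcovb : ⨆ j, ⨆ x : X, X.basicOpen ((CocycleSections.ofFrameSystem F h1 b).coeff j x) = ⊤ :=
    iSup_basicOpen_coeffAt_eq_top_of_charts f F h1 b H
  refine isProjective_of_generatingSections_fin_of_isPullback f
    (ofCocycleSections F.U (CocycleSections.ofFrameSystem F h1 b) hcovb) fun t ↦ ?_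
  obtain ⟨A, _, _, iV, X', g, f', Hg, hb', 𝔭, σ, hσ, X₀, iX, f₀, HX, hvan, h1₀, n, s, hcov, H₀⟩ := H t
  haveI : IsProper f' := MorphismProperty.of_isPullback Hg inferInstance
  haveI : Flat f' := MorphismProperty.of_isPullback Hg inferInstance
  -- on the chart: the restricted `η(b_j)` embed the fibre over `𝔭`
  obtain ⟨-, hcov₀, H₁⟩ := isClosedImmersion_toProj_comap_of_fibre_embedding_of_span f' 𝔭 HX (F.pullback g) (fun _ ↦ h1 _)
    hvan h1₀ s hcov H₀ (fun j ↦ unitSectionLE g E (V := ⊤) (U := ⊤) le_top (b j)) hb'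
  have hcov' := iSup_basicOpen_coeffAt_pullback_eq_top F h1 b g (fun _ ↦ h1 _) hcovb
  refine ⟨𝔭.asIdeal.ResidueField, inferInstance, Spec.map (CommRingCat.ofHom (algebraMap A 𝔭.asIdeal.ResidueField)) ≫ iV, σ,
    by rw [hσ], X₀, iX ≫ g, f₀, HX.paste_horiz Hg, ?_⟩
  exact isClosedImmersion_toProj_comap_comp g iX F h1 b hcovb (fun _ ↦ h1 _) hcov' f₀ hcov₀ H₁

end General

end Literature.AlgebraicGeometry.Morphisms
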